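import Summits.QuantumFields.QCD.Theses.GluonFreeDual

/-!
# Route GluonFreeDual — Assembly (item stmt-QuantumFields-9718)

The assembly of route `route-QuantumFields-GluonFreeDual` (sub-problem `QCD` of the summit
`QuantumFields`) is pure logic:

`LatticeQCDGapAF → ContinuumFromLatticeGap → QCD`.

`LatticeQCDGapAF` hands, for `N_f = 2` and for `N_f = 3`, a Wilson regularisation with mass scaling,
asymptotic scaling, the physical branch and a physical-unit lattice mass gap for every positive mass
tuple; `ContinuumFromLatticeGap` turns exactly that package into `QCDOf N_f`; and `QCD` is by
definition the conjunction `QCDOf 2 ∧ QCDOf 3`.  Instantiate at `N_f = 2` and `N_f = 3` and pair.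
This is literally the type of the route's kernel-checked deciding theorem
`Summit.QuantumFields.QCD.Theses.GluonFreeDual.closes` (D-0027 §2.1); no analysis, no named facts;
axioms ⊆ {propext, Classical.choice, Quot.sound}.

References: A. Jaffe, E. Witten, *Quantum Yang–Mills theory* (Clay problem description, 2000);
K. Osterwalder, E. Seiler, *Gauge field theories on a lattice*, Ann. Phys. 110 (1978).
-/

namespace Summit.QuantumFields.QCD.Theorems

open Summit.QuantumFields.QCD.Theses.GluonFreeDual

/-- **Assembly of route GluonFreeDual** (item stmt-QuantumFields-9718):
`LatticeQCDGapAF → ContinuumFromLatticeGap → QCD`.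
Proof: for `N_f = 2` and `N_f = 3`, `LatticeQCDGapAF` supplies the gapped, asymptotically scaling,
mass-scaling regularisation and `ContinuumFromLatticeGap` converts it into `QCDOf N_f`; the pair
`QCDOf 2 ∧ QCDOf 3` is `QCD`. [folklore] -/
theorem gluonFreeDualAssembly_proof : Summit.QuantumFields.QCD.Theses.GluonFreeDual.Assembly := by
  unfold Summit.QuantumFields.QCD.Theses.GluonFreeDual.Assembly
  intro hL hC
  exact ⟨hC 2 (Or.inl rfl) (hL 2 (Or.inl rfl)), hC 3 (Or.inr rfl) (hL 3 (Or.inr rfl))⟩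

end Summit.QuantumFields.QCD.Theorems
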